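import Summits.NavierStokesRegularity.NavierStokesRegularity.Theorems.AxisymmetricExtremalityAxisymmetricKatoGlobalStubSeregin2020TypeIILemma22AxisMeasureTools
import Literature.Analysis.FluidPDE.SqIntegralBalance
import Mathlib.MeasureTheory.Measure.Lebesgue.EqHaar
import HarnessLib

/-!
# L22-B, piece F3c (8/·): tools for the excision-error package

Seregin 2020 Lemma 2.2 ⇐ N–U 2012 Lemma 4.2 for the class `𝒱` (cell ns-inputs, kit A1-L22B-F3).
Small tools used to discharge the hypothesis `hErr` of
`energyClass_acrossAxis_of_classV_of_excisionErrors` from the per-piece error bounds of record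
((e1) `excision_gradError_le`, (e2) `excision_driftError_le`, (e3) `excision_axisError_le`):
measurability / sign / size of the normalised pair `(Φ̃, Ũ)`, the pointwise Young bound
`u ≤ r²u³ + r⁻¹` integrated (`lintegral_enorm_le_sq_cube_add`), `min(a,b)³/(ab) ≤ b`, and the volume of
a ball of radius `4ρ` in `ℝ³`. [cite: NazarovUraltseva2012, §3 Remark 9]

Nothing here is a Navier–Stokes regularity statement.
-/

noncomputable section

set_option linter.dupNamespace false

open MeasureTheory Set Function Filter Topology TopologicalSpace Metric
open scoped NNReal ENNReal

namespace Summit.NavierStokesRegularity.NavierStokesRegularity.Theorems.AxisymmetricKatoGlobal.EulerScaling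

open Literature.Analysis.FluidPDE

/-- The normalised scalar `Φ̃` (`= Φ` on the open set `{t<0} ∖ S`, `= k` elsewhere) is measurable when
`Φ` is continuous on `{t<0} ∖ S` and `S` is closed. [folklore] -/
theorem measurable_uncurry_normalised {Φ Φ' : ℝ → EuclideanSpace ℝ (Fin 3) → ℝ}
    {S : Set (ℝ × EuclideanSpace ℝ (Fin 3))} {k : ℝ} (hSc : IsClosed S)
    (hΦc : ContinuousOn (uncurry Φ) ({z : ℝ × EuclideanSpace ℝ (Fin 3) | z.1 < 0} \ S))
    (hΦ'1 : ∀ t x, t < 0 → (t, x) ∉ S → Φ' t x = Φ t x) (hΦ'2 : ∀ t x, ¬ (t < 0 ∧ (t, x) ∉ S) → Φ' t x = k) :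
    Measurable (uncurry Φ') := by
  classical
  set W : Set (ℝ × EuclideanSpace ℝ (Fin 3)) := {z : ℝ × EuclideanSpace ℝ (Fin 3) | z.1 < 0} \ S with hW
  have hWo : IsOpen W := (isOpen_lt continuous_fst continuous_const).sdiff hSc
  have heq : uncurry Φ' = W.piecewise (uncurry Φ) (fun _ => k) := by
    funext z
    by_cases hz : z ∈ W
    · rw [piecewise_eq_of_mem _ _ _ hz]; exact hΦ'1 z.1 z.2 hz.1 hz.2
    · rw [piecewise_eq_of_notMem _ _ _ hz]
      exact hΦ'2 z.1 z.2 fun h => hz ⟨h.1, h.2⟩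
  rw [heq]
  exact hΦc.measurable_piecewise continuousOn_const hWo.measurableSet

/-- The normalised scalar is nonnegative when `Φ ≥ 0` off `S` for `t<0` and `k > 0`. [folklore] -/
theorem normalised_nonneg {Φ Φ' : ℝ → EuclideanSpace ℝ (Fin 3) → ℝ} {S : Set (ℝ × EuclideanSpace ℝ (Fin 3))} {k : ℝ}
    (hΦ0 : ∀ z : ℝ × EuclideanSpace ℝ (Fin 3), z.1 < 0 → z ∉ S → 0 ≤ Φ z.1 z.2) (hk : 0 < k)
    (hΦ'1 : ∀ t x, t < 0 → (t, x) ∉ S → Φ' t x = Φ t x) (hΦ'2 : ∀ t x, ¬ (t < 0 ∧ (t, x) ∉ S) → Φ' t x = k)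
    (t : ℝ) (x : EuclideanSpace ℝ (Fin 3)) : 0 ≤ Φ' t x := by
  by_cases h : t < 0 ∧ (t, x) ∉ S
  · rw [hΦ'1 t x h.1 h.2]; exact hΦ0 (t, x) h.1 h.2
  · rw [hΦ'2 t x h]; exact hk.le

/-- The normalised drift `Ũ` (`= U` on the open set `{t<0} × {ϱ≠0}`, `= 0` elsewhere) is a.e.-strongly
measurable when `U` is continuous off the axis. [folklore] -/
theorem aestronglyMeasurable_uncurry_normalisedU {U U' : ℝ → EuclideanSpace ℝ (Fin 3) → EuclideanSpace ℝ (Fin 3)}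
    (hUc : ContinuousOn (uncurry U) {z : ℝ × EuclideanSpace ℝ (Fin 3) | z.1 < 0 ∧ cylRadius z.2 ≠ 0})
    (hU'1 : ∀ t x, t < 0 → cylRadius x ≠ 0 → U' t x = U t x) (hU'2 : ∀ t x, ¬ (t < 0 ∧ cylRadius x ≠ 0) → U' t x = 0) :
    AEStronglyMeasurable (uncurry U') (volume : Measure (ℝ × EuclideanSpace ℝ (Fin 3))) := by
  classical
  set V : Set (ℝ × EuclideanSpace ℝ (Fin 3)) := {z | z.1 < 0 ∧ cylRadius z.2 ≠ 0} with hV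
  have hVo : IsOpen V :=
    (isOpen_lt continuous_fst continuous_const).inter (isOpen_ne_fun (continuous_cylRadius.comp continuous_snd) continuous_const)
  have heq : uncurry U' = V.piecewise (uncurry U) (fun _ => 0) := by
    funext z
    by_cases hz : z ∈ V
    · rw [piecewise_eq_of_mem _ _ _ hz]; exact hU'1 z.1 z.2 hz.1 hz.2
    · rw [piecewise_eq_of_notMem _ _ _ hz]; exact hU'2 z.1 z.2 fun h => hz ⟨h.1, h.2⟩
  rw [heq]
  exact (hUc.measurable_piecewise continuousOn_const hVo.measurableSet).aestronglyMeasurable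

/-- `‖Ũ‖ₑ ≤ ‖U‖ₑ` at negative times. [folklore] -/
theorem enorm_normalisedU_le {U U' : ℝ → EuclideanSpace ℝ (Fin 3) → EuclideanSpace ℝ (Fin 3)}
    (hU'1 : ∀ t x, t < 0 → cylRadius x ≠ 0 → U' t x = U t x) (hU'2 : ∀ t x, ¬ (t < 0 ∧ cylRadius x ≠ 0) → U' t x = 0)
    (t : ℝ) (x : EuclideanSpace ℝ (Fin 3)) : ‖U' t x‖ₑ ≤ ‖U t x‖ₑ := by
  by_cases h : t < 0 ∧ cylRadius x ≠ 0
  · rw [hU'1 t x h.1 h.2]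
  · rw [hU'2 t x h, enorm_zero]; exact bot_le

/-- The cube of the normalised drift is integrable on `[t₁,t₂] × B(0,2R)`, `-R² < t₁`, `t₂ < 0`, when
`∬_{Q(a)} |U|³ < ∞` for all `a > 0`. [folklore] -/
theorem lintegral_cube_normalisedU_lt_top {U U' : ℝ → EuclideanSpace ℝ (Fin 3) → EuclideanSpace ℝ (Fin 3)} {R t₁ t₂ : ℝ}
    (hU3 : ∀ a : ℝ, 0 < a → ∫⁻ z in parabolicCylinder a (0 : ℝ × EuclideanSpace ℝ (Fin 3)), ‖U z.1 z.2‖ₑ ^ (3 : ℕ) < ∞)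
    (hU'1 : ∀ t x, t < 0 → cylRadius x ≠ 0 → U' t x = U t x) (hU'2 : ∀ t x, ¬ (t < 0 ∧ cylRadius x ≠ 0) → U' t x = 0)
    (hR : 0 < R) (ht₁ : -R ^ 2 < t₁) (ht₂ : t₂ < 0) :
    (∫⁻ z in Icc t₁ t₂ ×ˢ ball (0 : EuclideanSpace ℝ (Fin 3)) (2 * R), ‖U' z.1 z.2‖ₑ ^ (3 : ℕ)) < ⊤ := by
  refine lt_of_le_of_lt ?_ (hU3 (2 * R) (by linarith))
  refine (lintegral_mono fun z => ?_).trans (lintegral_mono_set (fun z hz => ?_))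
  · exact pow_le_pow_left₀ (by simp) (enorm_normalisedU_le hU'1 hU'2 z.1 z.2) 3
  · simp only [parabolicCylinder, mem_prod, mem_Ioo, Prod.fst_zero, Prod.snd_zero, mem_Icc] at hz ⊢
    exact ⟨⟨by nlinarith [hz.1.1], lt_of_le_of_lt hz.1.2 ht₂⟩, hz.2⟩

/-- **Young, integrated:** `∫⁻_E ‖U‖ ≤ r² ∫⁻_E ‖U‖³ + r⁻¹ |E|` for `r > 0`
(pointwise `u ≤ u³/L² + L` with `L = r⁻¹`). [folklore] -/
theorem lintegral_enorm_le_sq_cube_add {E : Set (ℝ × EuclideanSpace ℝ (Fin 3))}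
    (U : ℝ → EuclideanSpace ℝ (Fin 3) → EuclideanSpace ℝ (Fin 3)) {r : ℝ} (hr : 0 < r) :
    ∫⁻ z in E, ‖U z.1 z.2‖ₑ ≤
      ENNReal.ofReal (r ^ 2) * (∫⁻ z in E, ‖U z.1 z.2‖ₑ ^ (3 : ℕ)) + ENNReal.ofReal r⁻¹ * volume E := by
  have hpt : ∀ z : ℝ × EuclideanSpace ℝ (Fin 3), ‖U z.1 z.2‖ₑ ≤
      ENNReal.ofReal (r ^ 2) * ‖U z.1 z.2‖ₑ ^ (3 : ℕ) + ENNReal.ofReal r⁻¹ := by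
    intro z
    have hu : 0 ≤ ‖U z.1 z.2‖ := norm_nonneg _
    have hy := le_cube_div_sq_add hu (inv_pos.2 hr)
    have e1 : ‖U z.1 z.2‖ ^ 3 / r⁻¹ ^ 2 = r ^ 2 * ‖U z.1 z.2‖ ^ 3 := by
      field_simp
    rw [e1] at hy
    calc ‖U z.1 z.2‖ₑ = ENNReal.ofReal ‖U z.1 z.2‖ := (ofReal_norm _).symm
      _ ≤ ENNReal.ofReal (r ^ 2 * ‖U z.1 z.2‖ ^ 3 + r⁻¹) := ENNReal.ofReal_le_ofReal hy
      _ = ENNReal.ofReal (r ^ 2) * ‖U z.1 z.2‖ₑ ^ (3 : ℕ) + ENNReal.ofReal r⁻¹ := by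
          rw [ENNReal.ofReal_add (by positivity) (by positivity), ENNReal.ofReal_mul (by positivity),
            ← ofReal_norm, ← ENNReal.ofReal_pow hu]
  calc ∫⁻ z in E, ‖U z.1 z.2‖ₑ ≤ ∫⁻ z in E, (ENNReal.ofReal (r ^ 2) * ‖U z.1 z.2‖ₑ ^ (3 : ℕ) + ENNReal.ofReal r⁻¹) :=
        lintegral_mono fun z => hpt z
    _ = ENNReal.ofReal (r ^ 2) * (∫⁻ z in E, ‖U z.1 z.2‖ₑ ^ (3 : ℕ)) + ENNReal.ofReal r⁻¹ * volume E := by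
        rw [lintegral_add_right _ measurable_const, lintegral_const_mul' _ _ ENNReal.ofReal_ne_top,
          lintegral_const, Measure.restrict_apply_univ]

/-- `min(a,b)³/(ab) ≤ b` for `a, b > 0`. [folklore] -/
theorem min_cube_div_le {a b : ℝ} (ha : 0 < a) (hb : 0 < b) : min a b ^ 3 / (a * b) ≤ b := by
  rw [div_le_iff₀ (mul_pos ha hb)]
  rcases le_total a b with h | h
  · rw [min_eq_left h]; nlinarith [mul_pos ha ha, mul_nonneg ha.le (sub_nonneg.2 h)]
  · rw [min_eq_right h]; nlinarith [mul_pos hb hb, mul_nonneg hb.le (sub_nonneg.2 h)]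

/-- Volume of a ball of radius `4ρ` in `ℝ³`: `64 ρ³ |B(0,1)|`. [folklore] -/
theorem volumeReal_ball_four_mul (c : EuclideanSpace ℝ (Fin 3)) {ρ : ℝ} (hρ : 0 ≤ ρ) :
    volume.real (ball c (4 * ρ)) = 64 * ρ ^ 3 * volume.real (ball (0 : EuclideanSpace ℝ (Fin 3)) 1) := by
  have h := Measure.addHaar_ball (volume : Measure (EuclideanSpace ℝ (Fin 3))) c (r := 4 * ρ) (by linarith)
  rw [finrank_euclideanSpace_fin] at h
  rw [measureReal_def, h, ENNReal.toReal_mul, ENNReal.toReal_ofReal (by positivity), measureReal_def]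
  ring

end Summit.NavierStokesRegularity.NavierStokesRegularity.Theorems.AxisymmetricKatoGlobal.EulerScaling

end
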